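import Summits.BirchSwinnertonDyer.Rank1Residual.X11b.Three.GoodReductionSubgroupUnramified
import Summits.BirchSwinnertonDyer.Rank1Residual.X11b.KummerLocalIndex
import Literature.NumberTheory.EllipticCurves.MatsunoCurvesRankProofs
import Literature.NumberTheory.EllipticCurves.ManinConstantAdditivePrimesProofs
import HarnessLib

/-!
# X11b at `p = 3` (team N8/O2), JET3-KUMMER (c): the CONNECTED Kummer condition `H¹_{Kum⁰}` on tree
# objects, Jetchev's Prop. 4.1 at a bad place in Kummer currency, and the link to the Jetchev road

HONEST FRAMING (cell `b2b-bsdres`, run/shared/lean/b2b/bsd-rank1-residual/, verbatim in every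
file): the goal of the cell is to DELETE the COMBINATION-SHAPED residual classes of the
Birch–Swinnerton-Dyer formula for ALL analytic-rank `≤ 1` elliptic curves over `ℚ` — "full BSD
formula for every rank `≤ 1` curve in class `C`" assembled STRICTLY from published theorems — so
that the rank-`≤ 1` remainder becomes exactly the CONSTRUCTION-SHAPED classes, which are TYPED
(missing-input `Prop`s), NOT attempted. This is not "finishing BSD". Team N8/O2 = `x11b3`, seat
`b2b-bsdres-x11b3-p1`, LEAD DEAL #4 A4.1 (3) row "JET3-KUMMER (c) typed `H¹_{Kum⁰}` + the LINK to
`ClassX11b.bsdp_of_jetchevChaCertificate_of_carayol`". ONE definition (`connectedKummerCondition`,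
Jetchev's `H¹_{Kum⁰}(K_v, E[n])` as a subgroup of the tree's `H¹(Γ_{K_v}, E[n])`) + THEOREMS; no
named fact; no `sorry`. Nothing is booked; the flag `JET@p|N` of `X11b/JetchevChaRoute.lean` is NOT
discharged here (what that would take is listed in §4); X11b stays CONSTRUCTION-SHAPED.

## What

Jetchev, Compos. Math. **144** (2008) §3.1.1 (p. 814): for a finite place `v` of `K` the *Kummer*
local condition `H¹_Kum(K_v, E[p^m])` is the image of `E(K_v)/p^m` under the local Kummer map, and
the *connected Kummer* condition `H¹_{Kum⁰}(K_v, E[p^m])` is the image of `E⁰(K_v)` (the points with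
nonsingular reduction); "`H¹_{Kum⁰} = H¹_Kum` unless `p ∣ c_v`" and Lemma 3.2 (p. 814: for `v ∣ N`
and `m > m_v := ord_p c_v`, `H¹_Kum/H¹_{Kum⁰} ≅ ℤ/p^{m_v}`). The tree has the Kummer condition
`𝓛_E = kummerLocalConditionAt W n E` and the local Kummer map on Mathlib's `E`-points
`localKummerMap W E hn : (W⁄E)(E) →+ H¹(Γ_E, E[n])` with `range = 𝓛_E`, `ker = n·(W⁄E)(E)`
(`Literature/…/LocalKummerMap.lean`), and `E₀ = goodReductionSubgroup` (`Literature/…/Tamagawa.lean`).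

* §1 **`connectedKummerCondition W E R hn := E₀(E).map (localKummerMap)`** (`E` a `K`-field with
  valuation ring `R`, `(W⁄E)` `R`-minimal) and its membership lemmas: `≤ 𝓛_E`; `δ(T) ∈ Kum⁰` for
  `T ∈ E₀`; **`δ(T) ∈ Kum⁰ ↔ T ∈ E₀ + n·E(E)`**; `δ(T) ∈ Kum⁰` for `T = T₀ + n T₁`, `T₀ ∈ E₀` —
  the form in which `JetchevKummerAtP.exists_mem_goodReductionSubgroup_add_pow_smul` concludes.
* §2 **Jetchev's Lemma 3.2 in index form**: `[𝓛_E : Kum⁰] = [E(E) : E₀ + n·E(E)]`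
  (`relIndex_connectedKummerCondition`, by multr1-p2's `KummerIndex.relIndex_map_range_eq_index_sup_ker`),
  hence `∣ c_v = localTamagawaNumber` (`MatsunoCurvesRankProofs.localTamagawaNumber_eq_index_…`) and
  **`Kum⁰ = 𝓛_E` when `c_v` is prime to `n`** (`…_of_coprime`; pure group theory: a quotient killed
  by `n` of order prime to `n` is trivial) — the kernel form of the lane census anatomy "bucket A
  (`q ≠ p`, `p ∤ c_p`): at `v ∣ p` the connected condition IS the Kummer condition, Prop. 4.1 at
  `v ∣ p` = Gross 1991 Prop. 6.2 (1) alone; bucket B (`q = p`, `p ∣ c_p`): the refinement is real".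
* §3 **Prop. 4.1 at a bad place, Kummer currency** (`localKummerMap_mem_connectedKummerCondition_of_cocycle`):
  in the dictionary of `JetchevKummerAtP` (`F = K_v`, `L = K[c]_w ⊇ F` Galois with valuation rings
  `R₀ → R` local, minimal equations over both), from `hstab`, (α) `hα`, the cocycle data
  `p^m U = ι P_c… − ι t`, `(σ−1)U = R_σ`, `n′P ∈ E₀(L)`, `n′R_σ ∈ E₀(L)` (`n′` prime to `p^m`):
  **`δ_v(t) ∈ H¹_{Kum⁰}(K_v, E[p^m])`** — p251610's point decomposition over `L` descended to `F`
  by p4's p252555 (`E₀(L)^{Gal} = ι E₀(F)`, `E(L)^{Gal} = ι E(F)`) and §1.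
* §4 **The link to the Jetchev road** (`X11b/JetchevChaRoute.lean`,
  `ClassX11b.bsdp_of_jetchevChaCertificate_of_carayol`, binder `hMJ` = Miller 2011 Thm. 5.4 in
  Cha's case, FLAGS `Miller11-Thm54-Cha-case` + `JET@p|N`): for `W/ℚ` globally minimal the objects
  at `q = p` are `connectedKummerCondition W ℚ_[p] ℤ_[p]` and the consumer's own
  `c_p = (W ⊗ ℚ_p).localTamagawaNumber ℤ_[p]`: `[𝓛_p : Kum⁰_p] ∣ c_p`
  (`relIndex_connectedKummerCondition_padic_dvd`) and **`p ∤ c_p ⇒ Kum⁰_p = 𝓛_p`**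
  (`connectedKummerCondition_padic_eq_of_not_dvd`). READING (harvest-2 E66 (C), not a theorem of
  this file): the flag `JET@p|N` records that Jetchev's printed Hypothesis (∗) has `p ∤ N` and that
  the one `p`-versus-`N` step of the printed proof is Prop. 4.1 at `v ∣ p` via Lemma 4.3; §3 is that
  step's replacement modulo the named inputs (a) Gross 1991 Prop. 6.2 (1) (`loc_v κ = δ_v(t)`),
  (b) [GZ86 III (3.1)] via Gross p. 245 (`n′y_c ∈ E⁰`), (α) `H¹(Gal(L_w/K_v), E₀(L_w)) = 0`, `hstab`;
  on pairs with `p ∤ c_p` (bucket A) §4 shows the step is (a) alone. A kernel DISCHARGE of the flag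
  would further need Jetchev §3, §§5–7 and Kolyvagin's structure theorem without `p ∤ N` (E66 (D),
  size L/XL) — not attempted; nothing here moves a tier (referee A's call).

References (locators only; no cited FACT): [cite: Jetchev2008, §3.1.1 and Lemma 3.2 (p. 814),
Prop. 4.1 (p. 819), Lemmas 4.2–4.3 (p. 820)] [cite: GrossLMS1991, Prop. 6.2 (1), pp. 244–245]
[cite: SilvermanAEC2009, VII.2 Prop. 2.1, VIII.§2, X.§4 diagram (**)] [cite: MilneADT2006, I.§6
(6.14)]; cell files `X11b/JetchevConnectedKummerCore.lean` (p248445), `Three/JetchevKummerAtP.lean`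
(p251610), `Three/GoodReductionSubgroupUnramified.lean` (p252555), `X11b/KummerLocalIndex.lean`,
`X11b/JetchevChaRoute.lean`; harvest-2 HARVEST.md §GEN-29 E66 (C)/(D).
-/

noncomputable section

open scoped Classical

namespace Summit.BirchSwinnertonDyer.Rank1Residual.X11b.Three.JetchevKummer

open WeierstrassCurve Literature.NumberTheory.EllipticCurves
  Literature.NumberTheory.GaloisRepresentations Field

universe u

/-! ### §0 Group theory: a quotient killed by `n` of order prime to `n` is trivial -/

/-- If every `n • a` lies in `H` and `[A : H]` is prime to `n`, then `H = ⊤`: each element of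
`A ⧸ H` has order dividing both `n` and `[A : H]`. (Index `0` = infinite is allowed: then
`Nat.Coprime 0 n` forces `n = 1`.) [folklore] -/
theorem addSubgroup_eq_top_of_nsmul_mem_of_coprime_index {A : Type*} [AddCommGroup A]
    (H : AddSubgroup A) {n : ℕ} (hn : ∀ a : A, n • a ∈ H) (hcop : Nat.Coprime H.index n) :
    H = ⊤ := by
  rw [eq_top_iff]
  intro a _
  have hq : addOrderOf (a : A ⧸ H) ∣ n :=
    addOrderOf_dvd_of_nsmul_eq_zero (by
      rw [← QuotientAddGroup.mk_nsmul, QuotientAddGroup.eq_zero_iff]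
      exact hn a)
  have hi : addOrderOf (a : A ⧸ H) ∣ H.index := addOrderOf_dvd_natCard (a : A ⧸ H)
  have h1 : addOrderOf (a : A ⧸ H) = 1 :=
    Nat.eq_one_of_dvd_coprimes hcop hi hq
  rw [← QuotientAddGroup.eq_zero_iff]
  exact AddMonoid.addOrderOf_eq_one_iff.mp h1

/-! ### §1 The connected Kummer condition `H¹_{Kum⁰}(E, W[n]) = δ(E₀(E))` -/

section Typed

variable {K : Type u} [Field K] [CharZero K] (W : WeierstrassCurve K) [W.IsElliptic]
  (E : Type u) [Field E] [Algebra K E]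
  (R : Type*) [CommRing R] [IsDomain R] [IsDiscreteValuationRing R] [Algebra R E]
  [IsFractionRing R E] [(W.baseChange E).IsMinimal R] {n : ℤ} (hn : n ≠ 0)

/-- **Jetchev's connected Kummer local condition `H¹_{Kum⁰}(E, W[n])`**: the image under the local
Kummer map `δ : (W⁄E)(E) → H¹(Γ_E, W[n])` (tree `localKummerMap`) of the subgroup
`E₀(E) = goodReductionSubgroup R (W⁄E)` of points with nonsingular reduction for the `R`-minimal
equation (`E` = a completion `K_v` with valuation ring `R`). Jetchev 2008 §3.1.1 (p. 814): "the
connected Kummer condition … the image of `E⁰(K_v)`"; "stringent" in the arXiv text.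
[cite: Jetchev2008, §3.1.1 (p. 814)] -/
def connectedKummerCondition :
    AddSubgroup (galoisCohomology (GaloisRep.restrictField E (W.torsionGaloisModule n)) 1) :=
  ((W.baseChange E).goodReductionSubgroup R).map (W.localKummerMap E hn)

/-- Unfolding: `c ∈ H¹_{Kum⁰}` iff `c = δ(P)` for some `P ∈ E₀(E)`. [cite: Jetchev2008, §3.1.1 (p. 814)] -/
theorem mem_connectedKummerCondition_iff
    (c : galoisCohomology (GaloisRep.restrictField E (W.torsionGaloisModule n)) 1) :
    c ∈ connectedKummerCondition W E R hn ↔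
      ∃ P ∈ (W.baseChange E).goodReductionSubgroup R, W.localKummerMap E hn P = c :=
  AddSubgroup.mem_map

/-- `H¹_{Kum⁰} ≤ H¹_Kum = 𝓛_E` (the connected condition refines the Kummer condition).
[cite: Jetchev2008, §3.1.1 (p. 814)] -/
theorem connectedKummerCondition_le_kummerLocalConditionAt :
    connectedKummerCondition W E R hn ≤ W.kummerLocalConditionAt n E := by
  rintro c ⟨P, -, rfl⟩
  exact W.localKummerMap_mem E hn P

/-- `δ(P) ∈ H¹_{Kum⁰}` for `P ∈ E₀(E)`. [cite: Jetchev2008, §3.1.1 (p. 814)] -/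
theorem localKummerMap_mem_connectedKummerCondition {P : (W.baseChange E).toAffine.Point}
    (hP : P ∈ (W.baseChange E).goodReductionSubgroup R) :
    W.localKummerMap E hn P ∈ connectedKummerCondition W E R hn :=
  AddSubgroup.mem_map_of_mem _ hP

variable [CharZero E]

/-- `δ` kills `n·(W⁄E)(E)` (exactness of the local Kummer sequence, tree `ker_localKummerMap`).
Silverman, *AEC*, VIII.§2. [folklore] -/
theorem localKummerMap_zsmul (P : (W.baseChange E).toAffine.Point) :
    W.localKummerMap E hn (n • P) = 0 := by
  rw [← AddMonoidHom.mem_ker, W.ker_localKummerMap E hn]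
  exact ⟨P, rfl⟩

/-- **`δ(T) ∈ H¹_{Kum⁰} ↔ T ∈ E₀(E) + n·(W⁄E)(E)`** (`ker δ = n·(W⁄E)(E)`). Jetchev 2008 §3.1.1;
Silverman, *AEC*, VIII.§2. [cite: Jetchev2008, §3.1.1 (p. 814)] -/
theorem localKummerMap_mem_connectedKummerCondition_iff (T : (W.baseChange E).toAffine.Point) :
    W.localKummerMap E hn T ∈ connectedKummerCondition W E R hn ↔
      T ∈ (W.baseChange E).goodReductionSubgroup R ⊔
        (zsmulAddGroupHom n : (W.baseChange E).toAffine.Point →+ _).range := by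
  constructor
  · rintro ⟨P, hP, hPT⟩
    have hker : T - P ∈ (W.localKummerMap E hn).ker := by
      rw [AddMonoidHom.mem_ker, map_sub, hPT, sub_self]
    rw [W.ker_localKummerMap E hn] at hker
    rw [show T = P + (T - P) by abel]
    exact AddSubgroup.add_mem_sup hP hker
  · intro hT
    obtain ⟨P, hP, Q, ⟨Q', rfl⟩, rfl⟩ := AddSubgroup.mem_sup.mp hT
    rw [map_add, zsmulAddGroupHom_apply, localKummerMap_zsmul W E hn Q', add_zero]
    exact localKummerMap_mem_connectedKummerCondition W E R hn hP

/-- **`δ(T) ∈ H¹_{Kum⁰}` for `T = T₀ + n T₁` with `T₀ ∈ E₀(E)`** — the shape in which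
`JetchevKummerAtP.exists_mem_goodReductionSubgroup_add_pow_smul` concludes (Jetchev's Prop. 4.1,
last line of the proof, p. 821). [cite: Jetchev2008, Prop. 4.1 (pp. 819–821)] -/
theorem localKummerMap_mem_connectedKummerCondition_of_eq_add_zsmul
    {T T₀ T₁ : (W.baseChange E).toAffine.Point}
    (h₀ : T₀ ∈ (W.baseChange E).goodReductionSubgroup R) (hT : T = T₀ + n • T₁) :
    W.localKummerMap E hn T ∈ connectedKummerCondition W E R hn := by
  rw [hT, map_add, localKummerMap_zsmul W E hn T₁, add_zero]
  exact localKummerMap_mem_connectedKummerCondition W E R hn h₀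

/-- `H¹_{Kum⁰} = 𝓛_E` iff `E₀(E) + n·(W⁄E)(E) = (W⁄E)(E)`. [cite: Jetchev2008, §3.1.1 (p. 814)] -/
theorem connectedKummerCondition_eq_iff_sup_eq_top :
    connectedKummerCondition W E R hn = W.kummerLocalConditionAt n E ↔
      (W.baseChange E).goodReductionSubgroup R ⊔
        (zsmulAddGroupHom n : (W.baseChange E).toAffine.Point →+ _).range = ⊤ := by
  constructor
  · intro h
    rw [eq_top_iff]
    intro T _
    rw [← localKummerMap_mem_connectedKummerCondition_iff W E R hn T, h]
    exact W.localKummerMap_mem E hn T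
  · intro h
    refine le_antisymm (connectedKummerCondition_le_kummerLocalConditionAt W E R hn) ?_
    rw [← W.range_localKummerMap E hn]
    rintro c ⟨T, rfl⟩
    rw [localKummerMap_mem_connectedKummerCondition_iff W E R hn T, h]
    exact AddSubgroup.mem_top T

/-! ### §2 Jetchev's Lemma 3.2 in index form: `[𝓛_E : Kum⁰] = [E(E) : E₀ + n E(E)] ∣ c_v` -/

/-- **`[𝓛_E : H¹_{Kum⁰}] = [(W⁄E)(E) : E₀(E) + n·(W⁄E)(E)]`** (`𝓛_E = range δ`, `ker δ = n·(W⁄E)(E)`,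
and `[f(A) : f(U)] = [A : U + ker f]`). For `n = p^m`, `m > m_v = ord_p c_v`, cyclic `E(K_v)/E⁰`:
`= p^{m_v}` (Jetchev's Lemma 3.2; not needed here). [cite: Jetchev2008, Lemma 3.2 (p. 814)] -/
theorem relIndex_connectedKummerCondition :
    (connectedKummerCondition W E R hn).relIndex (W.kummerLocalConditionAt n E) =
      ((W.baseChange E).goodReductionSubgroup R ⊔
        (zsmulAddGroupHom n : (W.baseChange E).toAffine.Point →+ _).range).index := by
  rw [connectedKummerCondition, ← W.range_localKummerMap E hn,
    KummerIndex.relIndex_map_range_eq_index_sup_ker, W.ker_localKummerMap E hn]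

omit [CharZero K] [CharZero E] in
/-- `[(W⁄E)(E) : E₀(E) + n·(W⁄E)(E)]` divides `c_v(E) = [(W⁄E)(E) : E₀(E)]`, the local Tamagawa
number of the minimal equation (tree `localTamagawaNumber_eq_index_goodReductionSubgroup`).
Silverman, *AEC*, VII.6 Ex. 7.6. [folklore] -/
theorem index_sup_dvd_localTamagawaNumber :
    ((W.baseChange E).goodReductionSubgroup R ⊔
        (zsmulAddGroupHom n : (W.baseChange E).toAffine.Point →+ _).range).index ∣
      (W.baseChange E).localTamagawaNumber R := by
  rw [WeierstrassCurve.localTamagawaNumber_eq_index_goodReductionSubgroup R (W.baseChange E)]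
  exact AddSubgroup.index_dvd_of_le le_sup_left

/-- **`[𝓛_E : H¹_{Kum⁰}] ∣ c_v(E)`**: the connected condition differs from the Kummer condition
by at most the Tamagawa number. Jetchev 2008 §3.1.1 / Lemma 3.2. [cite: Jetchev2008, Lemma 3.2 (p. 814)] -/
theorem relIndex_connectedKummerCondition_dvd_localTamagawaNumber :
    (connectedKummerCondition W E R hn).relIndex (W.kummerLocalConditionAt n E) ∣
      (W.baseChange E).localTamagawaNumber R := by
  rw [relIndex_connectedKummerCondition W E R hn]
  exact index_sup_dvd_localTamagawaNumber W E R (n := n)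

/-- **"`H¹_{Kum⁰} = H¹_Kum` unless `p ∣ c_v`"**: if `c_v(E)` is prime to `n` then the connected
Kummer condition is the whole Kummer condition `𝓛_E` (the quotient `(W⁄E)(E)/(E₀ + n E)` is
killed by `n` and has order dividing `c_v`). At such a place Jetchev's Prop. 4.1 reduces to the
unrefined Selmer membership of Gross 1991 Prop. 6.2 (1). Jetchev 2008 §3.1.1 (p. 814).
[cite: Jetchev2008, §3.1.1 (p. 814)] [cite: GrossLMS1991, Prop. 6.2 (1)] -/
theorem connectedKummerCondition_eq_of_coprime
    (hcop : Nat.Coprime ((W.baseChange E).localTamagawaNumber R) n.natAbs) :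
    connectedKummerCondition W E R hn = W.kummerLocalConditionAt n E := by
  rw [connectedKummerCondition_eq_iff_sup_eq_top W E R hn]
  refine addSubgroup_eq_top_of_nsmul_mem_of_coprime_index _ (n := n.natAbs) (fun T ↦ ?_) ?_
  · refine AddSubgroup.mem_sup_right ⟨Int.sign n • T, ?_⟩
    rw [zsmulAddGroupHom_apply, smul_smul, mul_comm, Int.sign_mul_self_eq_natAbs, natCast_zsmul]
  · exact Nat.Coprime.coprime_dvd_left (index_sup_dvd_localTamagawaNumber W E R (n := n)) hcop

/-- Special case `E₀(E) = (W⁄E)(E)` (e.g. good reduction, `c_v = 1`): `H¹_{Kum⁰} = 𝓛_E` for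
every `n` ("`H¹_{Kum⁰} = H¹_Kum` at a place of good reduction"). [cite: Jetchev2008, §3.1.1 (p. 814)] -/
theorem connectedKummerCondition_eq_of_goodReductionSubgroup_eq_top
    (h : (W.baseChange E).goodReductionSubgroup R = ⊤) :
    connectedKummerCondition W E R hn = W.kummerLocalConditionAt n E := by
  rw [connectedKummerCondition_eq_iff_sup_eq_top W E R hn, h, top_sup_eq]

end Typed

/-! ### §3 Jetchev's Prop. 4.1 at a bad place, in Kummer currency (local dictionary `F = K_v`) -/

section Local

variable {F : Type u} [Field F] [CharZero F] (W : WeierstrassCurve F) [W.IsElliptic]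
  (L : Type u) [Field L] [Algebra F L]
  (R₀ : Type*) [CommRing R₀] [IsDomain R₀] [IsDiscreteValuationRing R₀] [Algebra R₀ F]
  [IsFractionRing R₀ F]
  (R : Type*) [CommRing R] [IsDomain R] [IsDiscreteValuationRing R] [Algebra R L]
  [IsFractionRing R L]
  [Algebra R₀ R] [Algebra R₀ L] [IsScalarTower R₀ R L] [IsScalarTower R₀ F L]

/-- **Jetchev 2008, Prop. 4.1 at a bad place `v` (any `v ∣ N`, `v ∣ p` included), Kummer
currency, modulo the named inputs.** Dictionary (`JetchevKummerAtP`): `F = K_v` with valuation ring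
`R₀`, `L = K[c]_w ⊇ F` Galois with valuation ring `R`, `R₀ → R` local, the `v`-minimal equation
`W` minimal over both; `ι : E(F) ↪ E(L)` = `Affine.Point.baseChange F L`; `t ∈ E(K_v)` the point with
`loc_v κ_{c,m} = δ_v(t)` (input (a): Gross 1991 Prop. 6.2 (1) / McCallum Lemma 4.3, printed without a
`p`-versus-`v` condition); `U ∈ E(L)` with `p^m U = P_c − ι t`, `(σ−1)U = R_σ` (the explicit
cocycle, Jetchev (4) / McCallum Lemma 4.1); `n′P_c, n′R_σ ∈ E₀(L)`, `n′` prime to `p^m` (input (b):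
Jetchev Lemma 4.2 = [GZ86, III (3.1)] as used by Gross p. 245, `n′ = #E(ℚ)_tors`); `hstab`
(`E₀(L)` is `Gal(L/F)`-stable) and (α) (`H¹(Gal(L/F), E₀(L)) = 0` in the form "`(E(L)/E₀(L))^{Gal}`
is the image of `E(L)^{Gal}`", Gross p. 244 ← Milne *ADT* I.3.8). Conclusion:
**`δ_v(t) ∈ H¹_{Kum⁰}(K_v, E[p^m])`** — Prop. 4.1 at `v` WITHOUT Lemma 4.3 (no `p`-divisibility of
`E⁰(K_v^{ur})`, which is where the printed proof needs `v ∤ p`). Proof: p251610's decomposition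
`ι t = T₀ + p^m T₁` over `L` with `T₀ ∈ E₀(L)`, `T₀, T₁` fixed; p252555's descent `T₀ = ι t₀`,
`t₀ ∈ E₀(F)`, `T₁ = ι t₁`; injectivity of `ι`; §1.
[cite: Jetchev2008, Prop. 4.1 (pp. 819–821), Lemmas 4.2–4.3 (p. 820)]
[cite: GrossLMS1991, Prop. 6.2 (1), pp. 244–245] -/
theorem localKummerMap_mem_connectedKummerCondition_of_cocycle [IsGalois F L]
    [IsLocalHom (algebraMap R₀ R)] [(W.baseChange F).IsMinimal R₀] [(W.baseChange L).IsMinimal R]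
    (hstab : ∀ (σ : L ≃ₐ[F] L) (Q : (W.baseChange L).toAffine.Point),
      Q ∈ (W.baseChange L).goodReductionSubgroup R → σ • Q ∈ (W.baseChange L).goodReductionSubgroup R)
    (hα : ∀ Q : (W.baseChange L).toAffine.Point,
      (∀ σ : L ≃ₐ[F] L, σ • Q - Q ∈ (W.baseChange L).goodReductionSubgroup R) →
        ∃ Q' : (W.baseChange L).toAffine.Point, (∀ σ : L ≃ₐ[F] L, σ • Q' = Q') ∧
          Q - Q' ∈ (W.baseChange L).goodReductionSubgroup R)
    {p m n' : ℕ} (hcop : Nat.Coprime n' (p ^ m)) (hn : ((p ^ m : ℕ) : ℤ) ≠ 0)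
    {t : (W.baseChange F).toAffine.Point} {U P : (W.baseChange L).toAffine.Point}
    {Rσ : (L ≃ₐ[F] L) → (W.baseChange L).toAffine.Point}
    (hP : (n' : ℤ) • P ∈ (W.baseChange L).goodReductionSubgroup R)
    (hR : ∀ σ : L ≃ₐ[F] L, (n' : ℤ) • Rσ σ ∈ (W.baseChange L).goodReductionSubgroup R)
    (hU : ∀ σ : L ≃ₐ[F] L, σ • U - U = Rσ σ)
    (hpU : ((p ^ m : ℕ) : ℤ) • U = P - Affine.Point.baseChange (W' := W.toAffine) F L t) :
    W.localKummerMap F hn t ∈ connectedKummerCondition W F R₀ hn := by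
  obtain ⟨T₀, T₁, h0, h1, hT₀, hdec⟩ :=
    exists_mem_goodReductionSubgroup_add_pow_smul W L R hstab hα hcop
      (fun σ ↦ smul_baseChange W L σ t) hP hR hU hpU
  -- descent of the fixed pieces to `F`
  obtain ⟨t₀, ht₀, rfl⟩ :=
    (mem_goodReductionSubgroup_iff_exists_of_forall_smul_eq W L R₀ R h0).mp hT₀
  obtain ⟨t₁, rfl⟩ := exists_baseChange_eq_of_forall_smul_eq W L T₁ h1
  have ht : t = t₀ + ((p ^ m : ℕ) : ℤ) • t₁ := by
    apply Affine.Point.map_injective (W' := (W.baseChange F).toAffine) (f := Algebra.ofId F L)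
    change Affine.Point.baseChange (W' := W.toAffine) F L t =
      Affine.Point.baseChange (W' := W.toAffine) F L (t₀ + ((p ^ m : ℕ) : ℤ) • t₁)
    rw [map_add, map_zsmul, ← hdec]
  exact localKummerMap_mem_connectedKummerCondition_of_eq_add_zsmul W F R₀ hn ht₀ ht

end Local

/-! ### §4 The link to the Jetchev road on X11b: the objects at `q = p` for `W/ℚ` -/

section Padic

variable (W : WeierstrassCurve ℚ) [W.IsElliptic] [W.IsGloballyMinimal] (p : ℕ) [Fact p.Prime]

/-- A global minimal equation over `ℚ` is `ℤ_p`-minimal in `ℚ_[p]` (tree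
`isMinimal_map_padic_of_isGloballyMinimal`); instance form for `W.baseChange ℚ_[p]`.
[cite: SilvermanAEC2009, VIII.8 (global minimal equations)] -/
instance isMinimal_baseChange_padic : (W.baseChange ℚ_[p]).IsMinimal ℤ_[p] :=
  isMinimal_map_padic_of_isGloballyMinimal W p

/-- **At `q = p`, `[𝓛_p : H¹_{Kum⁰}(ℚ_p, E[n])] ∣ c_p(E)`** with `c_p(E) = (W ⊗ ℚ_p).localTamagawaNumber ℤ_[p]`
— the SAME quantity as the binder `hI : ord_p [E(K):ℤ y_K] ≤ ord_p c_q` of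
`ClassX11b.bsdp_of_jetchevChaCertificate_of_carayol` at `q = p` (at `v ∣ p` of the Heegner field,
`p` split, `K_v = ℚ_p`). [cite: Jetchev2008, Lemma 3.2 (p. 814)] -/
theorem relIndex_connectedKummerCondition_padic_dvd {n : ℤ} (hn : n ≠ 0) :
    (connectedKummerCondition W ℚ_[p] ℤ_[p] hn).relIndex (W.kummerLocalConditionAt n ℚ_[p]) ∣
      (W.baseChange ℚ_[p]).localTamagawaNumber ℤ_[p] :=
  relIndex_connectedKummerCondition_dvd_localTamagawaNumber W ℚ_[p] ℤ_[p] hn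

/-- **Bucket A of the `JET@p|N` census in the kernel: if `p ∤ c_p(E)` then at `q = p`
`H¹_{Kum⁰}(ℚ_p, E[p^m]) = H¹_Kum(ℚ_p, E[p^m])` for every `m`** — the connected refinement of
Jetchev's Prop. 4.1 is VACUOUS at the place above `p`, so there Prop. 4.1 is Gross 1991 Prop. 6.2 (1)
(unrefined Selmer membership, printed with no `p`-versus-`v` condition) and nothing else; the
refinement (§3 with inputs (b), (α)) is needed only when `p ∣ c_p` (bucket B: split `I_{kp}` at `p`).
Lane census of record (bsdN/sweep/v5/jet, harvest-2 E66): bucket A 167 575 / bucket B 71 505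
classes — EVIDENCE pointers, not inputs. [cite: Jetchev2008, §3.1.1 (p. 814), Prop. 4.1 (p. 819)]
[cite: GrossLMS1991, Prop. 6.2 (1)] -/
theorem connectedKummerCondition_padic_eq_of_not_dvd
    (hc : ¬ p ∣ (W.baseChange ℚ_[p]).localTamagawaNumber ℤ_[p]) (m : ℕ) :
    connectedKummerCondition W ℚ_[p] ℤ_[p]
        (n := ((p ^ m : ℕ) : ℤ)) (Int.natCast_ne_zero.mpr (pow_ne_zero m (Fact.out : p.Prime).ne_zero)) =
      W.kummerLocalConditionAt ((p ^ m : ℕ) : ℤ) ℚ_[p] := by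
  refine connectedKummerCondition_eq_of_coprime W ℚ_[p] ℤ_[p] _ ?_
  rw [Int.natAbs_natCast]
  exact (Nat.Coprime.pow_right m
    ((Nat.coprime_comm.mp ((Fact.out : p.Prime).coprime_iff_not_dvd.mpr hc))))

end Padic

end Summit.BirchSwinnertonDyer.Rank1Residual.X11b.Three.JetchevKummer

end
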